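import Mathlib
import HarnessLib
import Summits.Ventures.LatticeQCDFlow.Scoring.HMCKernelSymmetry
import Literature.MathematicalPhysics.QuantumFieldTheory.LatticeGaugeStaticPotentialProofs
import Literature.MathematicalPhysics.QuantumFieldTheory.PlaquetteWeightSiteRPConjugate

/-!
# The HMC kernel of arm E2 commutes with every permutation of the coordinate axes (momenta relabelled with the links)

HONEST FRAMING: exact (Metropolis-corrected) sampling algorithms for lattice gauge theory;
figures of merit are autocorrelation/cost numbers at stated couplings and volumes; no
continuum-physics claim.

Venture `LatticeQCDFlow` (cell pub-lqcd), sub-topic `Scoring`, FANOUT row 21 (`su3-base`, arm `E2 = PBC-HMC`; row 16's arm E2 on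
`SU(2)` is the same kernel).  NEW WORK of the cell: the AXIS-PERMUTATION leg of the symmetry packet of row 16 (`KickDriftSymmetry`:
gauge / translation / time reflection of every kick–drift word; `MomentumLawSymmetry`: invariance of the momentum draw under
register isometries `coordMap`; `HMCKernelSymmetry`: the kernel `hmcKernel B β ε w`, `hmcStep`, `hmcNoise`, `conjKernel_hmcKernel`
for `Θ'`), over the Literature's coordinate permutations (`LatticeGaugeStaticPotentialProofs` (B): `sitePerm`, `edgePerm`,
`configPerm π`, `plaquetteHolonomy_configPerm`, `wilsonAction_configPerm`; `PlaquetteWeightSiteRPConjugate`: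
`WeightSiteRP.measurePreserving_configPerm`) and row 16's register calculus (`WilsonFlowRK3`: `flowGen`, `rkRegister`, `rkPush`;
`SymmetricSamplerOddObservables`: `map_bind_nHit_eq_self`).  Three definitions (the momentum relabelling `permReg`, its linear
form `permRegₗ`, the lifted map `permPhase`) ⇒ review lane; nothing is cited as a fact; no number.

## What is proved (every `d`, `L ≥ 1`, `n`, `β`, `ε`, kick–drift word `w`, basis `B`, axis permutation `π`)

* §1 `permReg π P (x, μ) = P(π⁻¹x, π⁻¹μ)` (momenta travel with their links); `flowGen_configPerm` (Lüscher's generator is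
  permutation-equivariant — the loop sum through a permuted link is the relabelled loop sum), `rkRegister_configPerm`,
  `rkPush_configPerm`, **`wilsonFlowRK3_configPerm`** / `iterate_wilsonFlowRK3_configPerm` (the engine's RK3 flow integrator — the
  MEASURED flowed field — is permutation covariant too); `permPhase`, **`mdWord_permPhase`** — EVERY kick–drift word commutes with the lifted permutation;
  `kinetic_permReg`, `mdHamiltonian_permPhase`, `energyChange_permPhase`.
* §2 `permRegₗ`, **`hmcStep_configPerm`** (`hmcStep (configPerm π U) (O_π c, u) = configPerm π (hmcStep U (c, u))`),
  `measurePreserving_noise_permReg`, **`hmcKernel_configPerm`** (`κ(configPerm π U) = (configPerm π)_* κ(U)`),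
  **`conjKernel_hmcKernel_configPerm`** (`conjKernel κ (configPerm π) = κ`).
* §3 `configPerm_one`, `dirac_one_map_configPerm`, `piHaar_map_configPerm` (cold and hot starts are permutation invariant);
  **`hmcChain_law_map_configPerm`**, **`integral_hmcChain_comp_configPerm`** — from any permutation-invariant start the `N`-step law
  of the chain is permutation invariant, every `N`: `∫ F(configPerm π U) d(μ₀κᴺ) = ∫ F d(μ₀κᴺ)` for every observable;
  `integral_hmcChain_plaquette_configPerm` (plaquette one-point functions at every step do not depend on the orientation); cold/hot
  corollaries.
With `HMCKernelSymmetry` (`Θ'`), `HMCKernelTranslation` and this file, arm E2's kernel commutes with the translations, the axis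
permutations and the time reflection of the torus.  NOT CLAIMED: arm E1; stationarity; reflections of single spatial axes; numbers.
-/

noncomputable section

open Matrix MeasureTheory ProbabilityTheory ProbabilityTheory.Kernel
open Literature.MathematicalPhysics.QuantumFieldTheory
open Literature.MathematicalPhysics.QuantumFieldTheory.Luscher2010 (SuBasis)
open Literature.MathematicalPhysics.QuantumLattice (fundamentalRep continuous_fundamentalRep)
open Summit.Ventures.LatticeQCDFlow.Exactness (conjKernel conjKernel_apply nHit)

namespace Summit.Ventures.LatticeQCDFlow.Scoring

variable {d L n : ℕ}

/-! ## §1 Registers, generator, kicks and drifts under an axis permutation -/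

section Registers

variable (π : Equiv.Perm (Fin d))

/-- **The momentum relabelling of an axis permutation**: the momentum of the link `(x, μ)` of the permuted configuration is the
momentum of the link `(π⁻¹x, π⁻¹μ)` it came from. -/
def permReg (P : Edge d L → suAlgebra n) : Edge d L → suAlgebra n := fun e => P (sitePerm π.symm e.1, π.symm e.2)

/-- `permReg` evaluated. -/
@[simp] theorem permReg_apply (P : Edge d L → suAlgebra n) (e : Edge d L) :
    permReg π P e = P (sitePerm π.symm e.1, π.symm e.2) := rfl

/-- `permReg` is linear: scalars. -/
theorem permReg_smul (c : ℝ) (P : Edge d L → suAlgebra n) : permReg π (c • P) = c • permReg π P := rfl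

/-- `permReg` is linear: sums. -/
theorem permReg_add (P Q : Edge d L → suAlgebra n) : permReg π (P + Q) = permReg π P + permReg π Q := rfl

/-- **Lüscher's generator is permutation-equivariant**: `Z(configPerm π V) = permReg π (Z V)` — the loop sum through a link of the
permuted configuration is the loop sum of the original configuration through the link it came from (relabel the transverse
directions by `π`; no link is reversed). -/
theorem flowGen_configPerm (V : GaugeConfig d L (Matrix.specialUnitaryGroup (Fin n) ℂ)) :
    flowGen (configPerm π V) = permReg π (flowGen V) := by
  have hsub : ∀ (y : Site d L) (ν : Fin d),
      sitePerm π.symm (y - Pi.single ν 1) = sitePerm π.symm y - Pi.single (π.symm ν) 1 := fun y ν => by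
    rw [sub_eq_add_neg, ← Pi.single_neg, sitePerm_add, sitePerm_single, Pi.single_neg, ← sub_eq_add_neg]
  have hloop : ∀ (x : Site d L) (μ : Fin d),
      plaquetteLoopSum (configPerm π V) x μ = plaquetteLoopSum V (sitePerm π.symm x) (π.symm μ) := fun x μ => by
    unfold plaquetteLoopSum
    simp only [plaquetteHolonomy_configPerm, configPerm_apply, hsub]
    exact Fintype.sum_equiv π.symm _ _ fun ν => by simp only [EmbeddingLike.apply_eq_iff_eq]
  funext e
  apply Subtype.ext
  rw [permReg_apply, coe_flowGen, coe_flowGen, hloop]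

/-- Register updates (kicks) commute with the permutation. -/
theorem rkRegister_configPerm (a b ε : ℝ) (X : Edge d L → suAlgebra n)
    (W : GaugeConfig d L (Matrix.specialUnitaryGroup (Fin n) ℂ)) :
    rkRegister a b ε (permReg π X) (configPerm π W) = permReg π (rkRegister a b ε X W) := by
  funext e
  simp only [rkRegister, permReg_apply, flowGen_configPerm π W]

/-- Exponential pushes (drifts) commute with the permutation. -/
theorem rkPush_configPerm (X : Edge d L → suAlgebra n) (W : GaugeConfig d L (Matrix.specialUnitaryGroup (Fin n) ℂ)) :
    rkPush (permReg π X) (configPerm π W) = configPerm π (rkPush X W) := by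
  funext e
  simp only [rkPush, permReg_apply, configPerm_apply]


/-- The zero register is permutation invariant. -/
@[simp] theorem permReg_zero : permReg (L := L) π (fun _ => (0 : suAlgebra n)) = fun _ => 0 := rfl

/-- **Permutation covariance of Lüscher's RK3 integrator** (the engine's `lc_flow_rk3_step`):
`RK3_ε(configPerm π V) = configPerm π (RK3_ε V)`. -/
theorem wilsonFlowRK3_configPerm (ε : ℝ) (V : GaugeConfig d L (Matrix.specialUnitaryGroup (Fin n) ℂ)) :
    wilsonFlowRK3 ε (configPerm π V) = configPerm π (wilsonFlowRK3 ε V) := by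
  simp only [wilsonFlowRK3]
  conv_lhs => rw [← permReg_zero π]
  simp only [rkRegister_configPerm, rkPush_configPerm]

/-- The same for any number of RK3 steps (the MEASURED flowed field). -/
theorem iterate_wilsonFlowRK3_configPerm (ε : ℝ) (m : ℕ) (V : GaugeConfig d L (Matrix.specialUnitaryGroup (Fin n) ℂ)) :
    (wilsonFlowRK3 ε)^[m] (configPerm π V) = configPerm π ((wilsonFlowRK3 ε)^[m] V) :=
  Function.Commute.iterate_left (fun U => wilsonFlowRK3_configPerm π ε U) m V

/-- The axis permutation lifted to phase space: links by `configPerm π`, momenta by `permReg π`. -/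
def permPhase (z : MDPhase d L n) : MDPhase d L n := (configPerm π z.1, permReg π z.2)

/-- Every instruction commutes with the lifted permutation. -/
theorem MDOp.apply_permPhase (ε : ℝ) (op : MDOp) (z : MDPhase d L n) :
    op.apply ε (permPhase π z) = permPhase π (op.apply ε z) := by
  cases op with
  | kick c => simp only [MDOp.apply, permPhase, rkRegister_configPerm]
  | drift a' => simp only [MDOp.apply, permPhase, ← permReg_smul, rkPush_configPerm]

/-- **Every kick–drift word is permutation equivariant.** -/
theorem mdWord_permPhase (ε : ℝ) (w : List MDOp) (z : MDPhase d L n) :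
    mdWord ε w (permPhase π z) = permPhase π (mdWord ε w z) := by
  induction w generalizing z with
  | nil => rfl
  | cons op w ih => rw [mdWord_cons, mdWord_cons, MDOp.apply_permPhase, ih]

variable [NeZero L]

/-- **`K(permReg π P) = K(P)`**: the relabelling re-enumerates the links. -/
theorem kinetic_permReg (P : Edge d L → suAlgebra n) : kinetic (permReg π P) = kinetic P :=
  Fintype.sum_equiv ((sitePerm π.symm).prodCongr π.symm) _ _ fun _ => rfl

/-- **`H` is invariant under the lifted permutation** for a permutation-invariant action. -/
theorem mdHamiltonian_permPhase {S : GaugeConfig d L (Matrix.specialUnitaryGroup (Fin n) ℂ) → ℝ}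
    (hS : ∀ U : GaugeConfig d L (Matrix.specialUnitaryGroup (Fin n) ℂ), S (configPerm π U) = S U) (z : MDPhase d L n) :
    mdHamiltonian S (permPhase π z) = mdHamiltonian S z := by
  simp only [mdHamiltonian, permPhase, hS, kinetic_permReg]

/-- `ΔH_w` is invariant under the lifted permutation for a permutation-invariant action. -/
theorem energyChange_permPhase {S : GaugeConfig d L (Matrix.specialUnitaryGroup (Fin n) ℂ) → ℝ}
    (hS : ∀ U : GaugeConfig d L (Matrix.specialUnitaryGroup (Fin n) ℂ), S (configPerm π U) = S U) (ε : ℝ) (w : List MDOp)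
    (z : MDPhase d L n) :
    mdHamiltonian S (mdWord ε w (permPhase π z)) - mdHamiltonian S (permPhase π z) =
      mdHamiltonian S (mdWord ε w z) - mdHamiltonian S z := by
  rw [mdWord_permPhase, mdHamiltonian_permPhase π hS, mdHamiltonian_permPhase π hS]

/-- The engine's action `β·S_W` is permutation invariant (Literature `wilsonAction_configPerm`). -/
theorem wilsonMDAction_configPerm (β : ℝ) (U : GaugeConfig d L (Matrix.specialUnitaryGroup (Fin n) ℂ)) :
    β * wilsonAction (fundamentalRep (Fin n)) (configPerm π U) = β * wilsonAction (fundamentalRep (Fin n)) U := by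
  rw [wilsonAction_configPerm (fundamentalRep (Fin n)) (continuous_fundamentalRep (Fin n))]

end Registers

/-! ## §2 The kernel commutes with the axis permutations -/

section Kernel

variable [NeZero L] (B : SuBasis n) (β ε : ℝ) (w : List MDOp) (π : Equiv.Perm (Fin d))

omit [NeZero L] in
/-- The momentum relabelling as a linear map. -/
def permRegₗ (π : Equiv.Perm (Fin d)) : (Edge d L → suAlgebra n) →ₗ[ℝ] (Edge d L → suAlgebra n) where
  toFun := permReg π
  map_add' _ _ := rfl
  map_smul' _ _ := rfl

omit [NeZero L] in
/-- `permRegₗ` acts as `permReg`. -/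
@[simp] theorem permRegₗ_apply (P : Edge d L → suAlgebra n) : permRegₗ (n := n) (L := L) π P = permReg π P := rfl

/-- **The update intertwines the permutation**: `hmcStep (configPerm π U) (O_π c, u) = configPerm π (hmcStep U (c, u))` with
`O_π = coordMap (permRegₗ π)` the relabelling of the momentum coefficients. -/
theorem hmcStep_configPerm (U : GaugeConfig d L (Matrix.specialUnitaryGroup (Fin n) ℂ))
    (c : Edge d L × B.ι → ℝ) (u : ℝ) :
    hmcStep B β ε w (configPerm π U) (coordMap B (permRegₗ π) c, u) = configPerm π (hmcStep B β ε w U (c, u)) := by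
  have hmom : momOf B (coordMap B (permRegₗ π) c) = permReg π (momOf B c) := (apply_momOf B (permRegₗ π) c).symm
  have hword : mdWord ε w (configPerm π U, permReg π (momOf B c)) = permPhase π (mdWord ε w (U, momOf B c)) :=
    mdWord_permPhase π ε w (U, momOf B c)
  have hΔ : energyChange B β ε w (configPerm π U) (coordMap B (permRegₗ π) c) = energyChange B β ε w U c := by
    unfold energyChange wilsonH
    rw [hmom]
    exact energyChange_permPhase π (wilsonMDAction_configPerm π β) ε w (U, momOf B c)
  unfold hmcStep
  simp only [hΔ]
  split_ifs with h
  · rw [hmom, hword]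
    rfl
  · rfl

/-- The relabelling of the noise `(c, u) ↦ (O_π c, u)` preserves its law. -/
theorem measurePreserving_noise_permReg :
    MeasurePreserving (Prod.map (coordMeasurableEquiv B (permRegₗ π) (kinetic_permReg π)) id)
      (hmcNoise B (d := d) (L := L)) (hmcNoise B) :=
  (measurePreserving_coordMap B (permRegₗ π) (kinetic_permReg π)).prod (MeasurePreserving.id _)

/-- **THE HMC KERNEL COMMUTES WITH EVERY AXIS PERMUTATION**: `κ(configPerm π U) = (configPerm π)_* κ(U)`. -/
theorem hmcKernel_configPerm (U : GaugeConfig d L (Matrix.specialUnitaryGroup (Fin n) ℂ)) :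
    hmcKernel B β ε w (configPerm π U) = (hmcKernel B β ε w U).map (configPerm π) := by
  rw [hmcKernel_apply, hmcKernel_apply]
  have hT := measurePreserving_noise_permReg B π (d := d) (L := L)
  have hmeasT : Measurable (Prod.map (coordMeasurableEquiv B (permRegₗ π) (kinetic_permReg π)) id :
      ((Edge d L × B.ι → ℝ) × ℝ) → (Edge d L × B.ι → ℝ) × ℝ) := hT.measurable
  have hfun : hmcStep B β ε w (configPerm π U) ∘ Prod.map (coordMeasurableEquiv B (permRegₗ π) (kinetic_permReg π)) id =
      (configPerm π) ∘ hmcStep B β ε w U := by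
    funext r
    obtain ⟨c, u⟩ := r
    simp only [Function.comp_apply, Prod.map_apply, id_eq, coordMeasurableEquiv_apply]
    exact hmcStep_configPerm B β ε w π U c u
  calc (hmcNoise B).map (hmcStep B β ε w (configPerm π U))
      = ((hmcNoise B).map (Prod.map (coordMeasurableEquiv B (permRegₗ π) (kinetic_permReg π)) id)).map
          (hmcStep B β ε w (configPerm π U)) := by rw [hT.map_eq]
    _ = (hmcNoise B).map (hmcStep B β ε w (configPerm π U) ∘
          Prod.map (coordMeasurableEquiv B (permRegₗ π) (kinetic_permReg π)) id) :=
        Measure.map_map (measurable_hmcStep_right B β ε w _) hmeasT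
    _ = (hmcNoise B).map ((configPerm π) ∘ hmcStep B β ε w U) := by rw [hfun]
    _ = ((hmcNoise B).map (hmcStep B β ε w U)).map (configPerm π) :=
        (Measure.map_map (configPerm π).measurable (measurable_hmcStep_right B β ε w U)).symm

omit [NeZero L] in
/-- `(configPerm π)⁻¹ = configPerm π⁻¹` on configurations. -/
theorem configPerm_symm_apply' (U : GaugeConfig d L (Matrix.specialUnitaryGroup (Fin n) ℂ)) :
    (configPerm π).symm U = configPerm π.symm U := by
  funext e
  simp only [configPerm_apply, Equiv.symm_symm]
  rfl

/-- **`conjKernel κ (configPerm π) = κ`** — the form consumed by `SymmetricSamplerOddObservables` / `KernelSymmetryOddObservables`. -/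
theorem conjKernel_hmcKernel_configPerm :
    conjKernel (hmcKernel B β ε w) (configPerm (G := Matrix.specialUnitaryGroup (Fin n) ℂ) (d := d) (L := L) π) =
      hmcKernel B β ε w := by
  refine ProbabilityTheory.Kernel.ext fun U => ?_
  rw [conjKernel_apply, configPerm_symm_apply', hmcKernel_configPerm,
    Measure.map_map (configPerm π).measurable (configPerm π.symm).measurable]
  have hid : ((configPerm (G := Matrix.specialUnitaryGroup (Fin n) ℂ) (L := L) π) ∘ (configPerm π.symm)) = id := by
    funext V
    simp only [Function.comp_apply, id_eq, ← configPerm_symm_apply', MeasurableEquiv.apply_symm_apply]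
  rw [hid, Measure.map_id]

end Kernel

/-! ## §3 Permutation-invariant starts stay permutation invariant -/

section Starts

variable [NeZero L] (B : SuBasis n) (β ε : ℝ) (w : List MDOp) (π : Equiv.Perm (Fin d))

omit [NeZero L] in
/-- The cold start `U ≡ 1` is permutation fixed. -/
theorem configPerm_one : configPerm π (1 : GaugeConfig d L (Matrix.specialUnitaryGroup (Fin n) ℂ)) = 1 := by
  funext e
  rw [configPerm_apply]
  rfl

omit [NeZero L] in
/-- The cold-start law `δ_{U ≡ 1}` is permutation invariant. -/
theorem dirac_one_map_configPerm :
    (Measure.dirac (1 : GaugeConfig d L (Matrix.specialUnitaryGroup (Fin n) ℂ))).map (configPerm π) = Measure.dirac 1 := by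
  rw [Measure.map_dirac' (configPerm π).measurable, configPerm_one]

/-- The hot-start law `∏ₑ dHaar(U_e)` is permutation invariant (the Literature's `WeightSiteRP.measurePreserving_configPerm`). -/
theorem piHaar_map_configPerm :
    (Measure.pi fun _ : Edge d L => haarProbability (Matrix.specialUnitaryGroup (Fin n) ℂ)).map (configPerm π) =
      Measure.pi fun _ : Edge d L => haarProbability (Matrix.specialUnitaryGroup (Fin n) ℂ) :=
  (WeightSiteRP.measurePreserving_configPerm (G := Matrix.specialUnitaryGroup (Fin n) ℂ) (L := L) π).map_eq

/-- **From any permutation-invariant start the `N`-step law of the HMC chain is permutation invariant**, every `N`. -/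
theorem hmcChain_law_map_configPerm {μ₀ : Measure (GaugeConfig d L (Matrix.specialUnitaryGroup (Fin n) ℂ))}
    (hμ₀ : μ₀.map (configPerm π) = μ₀) (N : ℕ) :
    (μ₀.bind (nHit (hmcKernel B β ε w) N)).map (configPerm π) = μ₀.bind (nHit (hmcKernel B β ε w) N) :=
  map_bind_nHit_eq_self (conjKernel_hmcKernel_configPerm B β ε w π) hμ₀ N

/-- **`∫ F(configPerm π U) d(μ₀κᴺ) = ∫ F d(μ₀κᴺ)`** for every observable, every `π`, every `N`, from any permutation-invariant start. -/
theorem integral_hmcChain_comp_configPerm {μ₀ : Measure (GaugeConfig d L (Matrix.specialUnitaryGroup (Fin n) ℂ))}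
    (hμ₀ : μ₀.map (configPerm π) = μ₀) (N : ℕ) {E : Type*} [NormedAddCommGroup E] [NormedSpace ℝ E]
    (F : GaugeConfig d L (Matrix.specialUnitaryGroup (Fin n) ℂ) → E) :
    ∫ U, F (configPerm π U) ∂(μ₀.bind (nHit (hmcKernel B β ε w) N)) = ∫ U, F U ∂(μ₀.bind (nHit (hmcKernel B β ε w) N)) :=
  (MeasurePreserving.mk (configPerm π).measurable (hmcChain_law_map_configPerm B β ε w π hμ₀ N)).integral_comp' F


/-- **Plaquette one-point functions of the chain do not depend on the orientation**: at every step `N`, from any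
permutation-invariant start, `⟨f(U_{x;ij})⟩_N = ⟨f(U_{π⁻¹x; π⁻¹i, π⁻¹j})⟩_N` for every function `f` of one plaquette holonomy
(the lattice-averaged plaquette of the run check averages identically distributed terms across orientations). -/
theorem integral_hmcChain_plaquette_configPerm {μ₀ : Measure (GaugeConfig d L (Matrix.specialUnitaryGroup (Fin n) ℂ))}
    (hμ₀ : μ₀.map (configPerm π) = μ₀) (N : ℕ) {E : Type*} [NormedAddCommGroup E] [NormedSpace ℝ E]
    (f : Matrix.specialUnitaryGroup (Fin n) ℂ → E) (x : Site d L) (i j : Fin d) :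
    ∫ U, f (plaquetteHolonomy U (sitePerm π.symm x) (π.symm i) (π.symm j)) ∂(μ₀.bind (nHit (hmcKernel B β ε w) N)) =
      ∫ U, f (plaquetteHolonomy U x i j) ∂(μ₀.bind (nHit (hmcKernel B β ε w) N)) := by
  have h := integral_hmcChain_comp_configPerm B β ε w π hμ₀ N (fun U => f (plaquetteHolonomy U x i j))
  simp only [plaquetteHolonomy_configPerm] at h
  exact h

/-- **Cold start**: `∫ F(configPerm π U) d(δ₁κᴺ) = ∫ F d(δ₁κᴺ)`. -/
theorem integral_hmcColdStart_comp_configPerm (N : ℕ) {E : Type*} [NormedAddCommGroup E] [NormedSpace ℝ E]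
    (F : GaugeConfig d L (Matrix.specialUnitaryGroup (Fin n) ℂ) → E) :
    ∫ U, F (configPerm π U) ∂((Measure.dirac 1).bind (nHit (hmcKernel B β ε w) N)) =
      ∫ U, F U ∂((Measure.dirac 1).bind (nHit (hmcKernel B β ε w) N)) :=
  integral_hmcChain_comp_configPerm B β ε w π (dirac_one_map_configPerm π) N F

/-- **Hot start**: `∫ F(configPerm π U) d((∏ dHaar)κᴺ) = ∫ F d((∏ dHaar)κᴺ)`. -/
theorem integral_hmcHotStart_comp_configPerm (N : ℕ) {E : Type*} [NormedAddCommGroup E] [NormedSpace ℝ E]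
    (F : GaugeConfig d L (Matrix.specialUnitaryGroup (Fin n) ℂ) → E) :
    ∫ U, F (configPerm π U) ∂((Measure.pi fun _ : Edge d L => haarProbability (Matrix.specialUnitaryGroup (Fin n) ℂ)).bind
          (nHit (hmcKernel B β ε w) N)) =
      ∫ U, F U ∂((Measure.pi fun _ : Edge d L => haarProbability (Matrix.specialUnitaryGroup (Fin n) ℂ)).bind
          (nHit (hmcKernel B β ε w) N)) :=
  integral_hmcChain_comp_configPerm B β ε w π (piHaar_map_configPerm π) N F

end Starts

end Summit.Ventures.LatticeQCDFlow.Scoring
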